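import Summits.BirchSwinnertonDyer.BirchSwinnertonDyer.Theorems.BiquadraticEisensteinDescentHeegnerTwistCouplingInSupplySymbolicMonskyEvenDesignExistsPencil
import HarnessLib

set_option linter.dupNamespace false -- `Summit.BirchSwinnertonDyer.BirchSwinnertonDyer.Theorems.…` (summit = sub)
set_option autoImplicit false

/-!
# Crux `HeegnerTwistCouplingInSupply` (stmt-BirchSwinnertonDyer-21381) — the EVEN one-stage door has an EXCEPTIONAL CLASS:
# `δ`-independent lower bounds for the three plane sections of the even pencil (obstruction to EVEN THEOREM A)

Route `BiquadraticEisensteinDescent` (cell `pub/bsd-wall`, width seat `bsd-wall-cm-bed-w3` g24; `--supports` 21381, helper). EVEN THEOREM A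
(`…SymbolicMonskyEvenDesignExistsPencil.exists_patternFree_even_design_pencil`, w3 g23) produces a pattern-free Heegner recipe on the even base
`E_{2·P₀⋯P_k}` from a `(2/·)`-vector `δ` whose even pencil `W_ev(δ) = T_δ(𝒦_ev) + ⟨(δ, 1+δ)⟩` has dimension `2τ` and meets `V × 0`, `0 × V` and the
diagonal in dimension `≤ τ`. Memo THEOREM-B-w3g23 §5 conjectured that such a `δ` ALWAYS exists («EVEN UNIVERSALITY»). THIS IS FALSE, and this file
proves the mechanism: the even twist `T_δ (u, v) = (v + ⟨m,u⟩(1+δ), u)` is injective and maps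
* the kernel pairs `(0, v)` into `W_ev(δ) ∩ (V × 0)`,
* the kernel pairs `(u, 0)` with `⟨m,u⟩ = 0` into `W_ev(δ) ∩ (0 × V)`,
* the kernel pairs `(u, u)` with `⟨m,u⟩ = 0` into `W_ev(δ) ∩ Δ`,
for EVERY `δ` (`⟨m,u⟩ = Σ_j [P_j ≡ 3 (4)] u_j`). Hence (★ `even_design_obstruction_snd/fst/diag`) if the even virtual kernel contains more than `τ`
independent pairs of one of these three shapes, the corresponding hypothesis of EVEN THEOREM A fails for every `δ`: the one-stage even door is CLOSED
on that base («even exceptional class»), exactly as the odd exceptional class `κ_u + ε > τ₀` of memo THEOREM-A-w3g22.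

NUMERICAL FACTS (memo EVEN-EXCEPTIONAL-CLASS-w3g24.md on the crux; scripts `work/signtable/evU_*.py`, `evfast.py`; not kernel-checked here):
the first even exceptional bases appear at `K = 5` primes — e.g. classes `(3,5,5,5,5) mod 8` with `(P_j/P₀) = −1`, `(P_i/P_j) = +1`
(`𝒦_ev = 0 × {v : v₀ = 0, Σ v_i = 0}`, `s_ev = 3 = a₁ > τ = 2`; 20 of the 524 288 bases with `K = 5`, none with `K ≤ 4`), and a second («horizontal»)
class at `K = 11` (all `P_i ≡ 3 (4)`, three twin pairs: `a₃ = 3 > τ = 2`); conversely in 34 206 + 377 508 + 118 518 sampled bases (`K ≤ 12`) a good `δ`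
exists — indeed at least half of all `δ` are good — EXACTLY when the three lower bounds of this file are `≤ τ`.

HONEST FRAMING: RUNG-LEVEL corner layer (even congruent `j = 1728` families `E_{2n₀}`); statements about `𝔽₂`-subspaces attached to Monsky matrices; the
crux as stated (C⁺), its registered stubs and BSD are NOT touched; nothing is closed. THEOREMS ONLY (no `def`, no instance, no notation).
Reference: [HeathBrown1994] D. R. Heath-Brown, Invent. Math. 118 (1994) 331–370, appendix (Monsky), typescript p. 41 L20–L36.
-/

namespace Summit.BirchSwinnertonDyer.BirchSwinnertonDyer.Theorems.SymbolicMonsky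

section EvenObstruction

open Module

variable {k : ℕ} (base : SymbData (k + 1))

/-- The even twist `T_δ (u, v) = (v + ⟨m,u⟩(1+δ), u)` is injective (the second component returns `u`, then the first returns `v`). -/
theorem evenTwist_injective (δ : Fin (k + 1) → ZMod 2) : Function.Injective (base.evenTwist δ) := by
  intro p q hpq
  rw [evenTwist_apply, evenTwist_apply] at hpq
  have h2 : p.1 = q.1 := congrArg Prod.snd hpq
  have h1 := congrArg Prod.fst hpq
  refine Prod.ext h2 ?_
  funext i
  have hi := congrFun h1 i
  simp only at hi
  rw [h2] at hi
  -- `p.2 i + c = q.2 i + c`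
  exact add_right_cancel hi

/-- A subspace `P` of kernel pairs mapped by the even twist into `W_ev(δ) ∩ Π` has `finrank P ≤ finrank (W_ev(δ) ∩ Π)`. -/
private theorem finrank_le_of_twist_maps_into (δ : Fin (k + 1) → ZMod 2)
    (P Pl : Submodule (ZMod 2) ((Fin (k + 1) → ZMod 2) × (Fin (k + 1) → ZMod 2)))
    (hP : P ≤ base.evenVirtualKernel) (hPl : ∀ p ∈ P, base.evenTwist δ p ∈ Pl) :
    finrank (ZMod 2) ↥P ≤ finrank (ZMod 2) ↥(base.evenPencil δ ⊓ Pl) := by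
  have hmap : P.map (base.evenTwist δ) ≤ base.evenPencil δ ⊓ Pl := by
    intro x hx
    rw [Submodule.mem_map] at hx
    obtain ⟨p, hp, rfl⟩ := hx
    refine Submodule.mem_inf.2 ⟨?_, hPl p hp⟩
    unfold SymbData.evenPencil
    exact Submodule.mem_sup_left (Submodule.mem_map_of_mem (hP hp))
  calc finrank (ZMod 2) ↥P = finrank (ZMod 2) ↥(P.map (base.evenTwist δ)) :=
        (LinearEquiv.finrank_eq (Submodule.equivMapOfInjective _ (evenTwist_injective base δ) P))
    _ ≤ finrank (ZMod 2) ↥(base.evenPencil δ ⊓ Pl) := Submodule.finrank_mono hmap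

/-- ★ **Obstruction at the plane `V × 0`.** Any subspace `P` of even kernel pairs of the shape `(0, v)` injects, for EVERY `δ`, into
`W_ev(δ) ∩ (V × 0)` (under `T_δ (0, v) = (v, 0)`): `finrank P ≤ finrank (W_ev(δ) ⊓ ker snd)`. So a base with more than `τ` independent kernel pairs
`(0, v)` («vertical» even exceptional class, e.g. `(3,5,5,5,5) mod 8` with `(P_j/P₀) = −1`) admits NO `δ` satisfying hypothesis `h1` of EVEN THEOREM A.
[cite: HeathBrown1994SelmerCongruentII, Appendix (Monsky), typescript p. 41 L20–L36] -/
theorem finrank_le_evenPencil_inf_ker_snd (δ : Fin (k + 1) → ZMod 2)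
    (P : Submodule (ZMod 2) ((Fin (k + 1) → ZMod 2) × (Fin (k + 1) → ZMod 2)))
    (hP : P ≤ base.evenVirtualKernel) (h0 : ∀ p ∈ P, p.1 = 0) :
    finrank (ZMod 2) ↥P ≤ finrank (ZMod 2) ↥(base.evenPencil δ ⊓
      LinearMap.ker (LinearMap.snd (ZMod 2) (Fin (k + 1) → ZMod 2) (Fin (k + 1) → ZMod 2))) := by
  refine finrank_le_of_twist_maps_into base δ P _ hP fun p hp => ?_
  rw [LinearMap.mem_ker, LinearMap.snd_apply, evenTwist_apply]
  exact h0 p hp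

/-- ★ **Obstruction at the plane `0 × V`.** Any subspace `P` of even kernel pairs of the shape `(u, 0)` with `⟨m,u⟩ = Σ_j [P_j ≡ 3 (4)] u_j = 0`
injects, for EVERY `δ`, into `W_ev(δ) ∩ (0 × V)` (under `T_δ (u, 0) = (0, u)`): `finrank P ≤ finrank (W_ev(δ) ⊓ ker fst)`.
[cite: HeathBrown1994SelmerCongruentII, Appendix (Monsky), typescript p. 41 L20–L36] -/
theorem finrank_le_evenPencil_inf_ker_fst (δ : Fin (k + 1) → ZMod 2)
    (P : Submodule (ZMod 2) ((Fin (k + 1) → ZMod 2) × (Fin (k + 1) → ZMod 2)))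
    (hP : P ≤ base.evenVirtualKernel) (h0 : ∀ p ∈ P, p.2 = 0)
    (hm : ∀ p ∈ P, (∑ j, bz (negNegOne (base.cls j)) * p.1 j) = 0) :
    finrank (ZMod 2) ↥P ≤ finrank (ZMod 2) ↥(base.evenPencil δ ⊓
      LinearMap.ker (LinearMap.fst (ZMod 2) (Fin (k + 1) → ZMod 2) (Fin (k + 1) → ZMod 2))) := by
  refine finrank_le_of_twist_maps_into base δ P _ hP fun p hp => ?_
  rw [LinearMap.mem_ker, LinearMap.fst_apply, evenTwist_apply]
  funext i
  simp only [Pi.zero_apply]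
  rw [h0 p hp, hm p hp]
  simp

/-- ★ **Obstruction at the diagonal.** Any subspace `P` of even kernel pairs of the shape `(u, u)` with `⟨m,u⟩ = 0` injects, for EVERY `δ`, into
`W_ev(δ) ∩ Δ` (under `T_δ (u, u) = (u, u)`): `finrank P ≤ finrank (W_ev(δ) ⊓ ker (fst + snd))` («horizontal» even exceptional class, e.g. the
`K = 11` twin-pair base of the memo).
[cite: HeathBrown1994SelmerCongruentII, Appendix (Monsky), typescript p. 41 L20–L36] -/
theorem finrank_le_evenPencil_inf_diag (δ : Fin (k + 1) → ZMod 2)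
    (P : Submodule (ZMod 2) ((Fin (k + 1) → ZMod 2) × (Fin (k + 1) → ZMod 2)))
    (hP : P ≤ base.evenVirtualKernel) (hΔ : ∀ p ∈ P, p.2 = p.1)
    (hm : ∀ p ∈ P, (∑ j, bz (negNegOne (base.cls j)) * p.1 j) = 0) :
    finrank (ZMod 2) ↥P ≤ finrank (ZMod 2) ↥(base.evenPencil δ ⊓
      LinearMap.ker (LinearMap.fst (ZMod 2) (Fin (k + 1) → ZMod 2) (Fin (k + 1) → ZMod 2) +
        LinearMap.snd (ZMod 2) (Fin (k + 1) → ZMod 2) (Fin (k + 1) → ZMod 2))) := by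
  refine finrank_le_of_twist_maps_into base δ P _ hP fun p hp => ?_
  rw [LinearMap.mem_ker, LinearMap.add_apply, LinearMap.fst_apply, LinearMap.snd_apply, evenTwist_apply]
  funext i
  simp only [Pi.add_apply, Pi.zero_apply]
  rw [hΔ p hp, hm p hp]
  have h2 : ∀ x : ZMod 2, x + x = 0 := zmod_two_add_self
  simp [h2]

/-- ★★ **EVEN EXCEPTIONAL CLASS — the one-stage even door is closed.** If the even virtual kernel of a base contains a subspace `P` of pairs `(0, v)`
with `finrank P > τ`, then NO `δ` satisfies the plane hypothesis `h1` of EVEN THEOREM A (`exists_patternFree_even_design_pencil`) at this `τ`;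
likewise for pairs `(u, 0)`, `⟨m,u⟩ = 0` (hypothesis `h2`) and pairs `(u, u)`, `⟨m,u⟩ = 0` (hypothesis `h3`). Refutes the conjecture «EVEN
UNIVERSALITY» of memo THEOREM-B-w3g23 §5 in mechanism (the explicit bases are numerical: memo EVEN-EXCEPTIONAL-CLASS-w3g24).
[cite: HeathBrown1994SelmerCongruentII, Appendix (Monsky), typescript p. 41 L20–L36] -/
theorem even_design_obstruction (τ : ℕ)
    (P : Submodule (ZMod 2) ((Fin (k + 1) → ZMod 2) × (Fin (k + 1) → ZMod 2)))
    (hP : P ≤ base.evenVirtualKernel) (hτ : τ < finrank (ZMod 2) ↥P) :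
    ((∀ p ∈ P, p.1 = 0) → ∀ δ : Fin (k + 1) → ZMod 2, ¬ finrank (ZMod 2) ↥(base.evenPencil δ ⊓
        LinearMap.ker (LinearMap.snd (ZMod 2) (Fin (k + 1) → ZMod 2) (Fin (k + 1) → ZMod 2))) ≤ τ) ∧
    ((∀ p ∈ P, p.2 = 0) → (∀ p ∈ P, (∑ j, bz (negNegOne (base.cls j)) * p.1 j) = 0) →
      ∀ δ : Fin (k + 1) → ZMod 2, ¬ finrank (ZMod 2) ↥(base.evenPencil δ ⊓
        LinearMap.ker (LinearMap.fst (ZMod 2) (Fin (k + 1) → ZMod 2) (Fin (k + 1) → ZMod 2))) ≤ τ) ∧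
    ((∀ p ∈ P, p.2 = p.1) → (∀ p ∈ P, (∑ j, bz (negNegOne (base.cls j)) * p.1 j) = 0) →
      ∀ δ : Fin (k + 1) → ZMod 2, ¬ finrank (ZMod 2) ↥(base.evenPencil δ ⊓
        LinearMap.ker (LinearMap.fst (ZMod 2) (Fin (k + 1) → ZMod 2) (Fin (k + 1) → ZMod 2) +
          LinearMap.snd (ZMod 2) (Fin (k + 1) → ZMod 2) (Fin (k + 1) → ZMod 2))) ≤ τ) := by
  refine ⟨fun h0 δ hle => ?_, fun h0 hm δ hle => ?_, fun hΔ hm δ hle => ?_⟩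
  · exact absurd (lt_of_lt_of_le hτ ((finrank_le_evenPencil_inf_ker_snd base δ P hP h0).trans hle)) (lt_irrefl τ)
  · exact absurd (lt_of_lt_of_le hτ ((finrank_le_evenPencil_inf_ker_fst base δ P hP h0 hm).trans hle)) (lt_irrefl τ)
  · exact absurd (lt_of_lt_of_le hτ ((finrank_le_evenPencil_inf_diag base δ P hP hΔ hm).trans hle)) (lt_irrefl τ)

end EvenObstruction

section Cex

open Module

/-! ### The first even exceptional base, kernel-checked: `K = 5`, classes `(3,5,5,5,5) mod 8`, `(P_j/P₀) = −1`, `(P_i/P_j) = +1`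

The base datum is the literal `⟨![1, 2, 2, 2, 2], fun i _ => decide (i = 0)⟩ : SymbData 5` (class codes `1 ↦ 3 (8)`, `2 ↦ 5 (8)`; `up i j = [i = 0]`),
i.e. the even base `n = 2·p·r₁r₂r₃r₄`, `p ≡ 3 (8)`, `r_i ≡ 5 (8)`, `(r_i/p) = −1`, `(r_i/r_j) = +1` (root number `−1`: `n ≡ 6 (8)`). Its even virtual
kernel is `{(0, v) : v₀ = 0, v₁ = v₂ + v₃ + v₄}` (dimension `3`, all pairs vertical: `cex_kernel_shape`, `cex_mem`), so every even pencil has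
dimension `≤ 4` (`cex_finrank_pencil_le`) while its `V × 0` section has dimension `≥ 3` (`cex_three_le_finrank_section`): EVEN THEOREM A applies
to NO `(δ, τ)` (★★★ `even_universality_fails`). Exhaustively (script `evU_exc_search.py`, not kernel-checked) 20 of the 524 288 bases with `K = 5`
and none with `K ≤ 4` are exceptional. -/


/-- The completed symbol of the explicit base: `[(P_j/P_i) = −1] = [i = 0] + [j = 0]` in `𝔽₂` (star pattern). -/
private theorem cex_neg (i j : Fin 5) :
    bz ((⟨![1, 2, 2, 2, 2], fun i _ => decide (i = 0)⟩ : SymbData 5).neg i j) =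
      (if i = 0 then 1 else 0) + (if j = 0 then 1 else 0) := by
  revert i j
  decide

/-- Symbol values of the two classes of the explicit base (code `1` = `3 mod 8`, code `2` = `5 mod 8`). -/
private theorem cex_vals : bz (negNegOne 1) = 1 ∧ bz (negNegOne 2) = 0 ∧ bz (negTwo 1) = 1 ∧ bz (negTwo 2) = 1 := by
  decide

/-- The even kernel pairs `(u, v)` of the explicit base are vertical: `u = 0`, `v₀ = 0`, `v₁ = v₂ + v₃ + v₄`. -/
private theorem cex_kernel_shape (p : (Fin 5 → ZMod 2) × (Fin 5 → ZMod 2))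
    (hp : p ∈ (⟨![1, 2, 2, 2, 2], fun i _ => decide (i = 0)⟩ : SymbData 5).evenVirtualKernel) :
    p.1 = 0 ∧ p.2 0 = 0 ∧ p.2 1 = p.2 2 + p.2 3 + p.2 4 := by
  rw [mem_evenVirtualKernel_iff] at hp
  obtain ⟨hE1, hE2⟩ := hp
  have a0 := hE1 0
  have a1 := hE1 1
  have a2 := hE1 2
  have a3 := hE1 3
  have a4 := hE1 4
  have b0 := hE2 0
  have b1 := hE2 1
  have b2 := hE2 2
  have b3 := hE2 3
  have b4 := hE2 4
  simp (config := { decide := true }) [Fin.sum_univ_succ, cex_neg, cex_vals] at a0 a1 a2 a3 a4 b0 b1 b2 b3 b4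
  have h2 : ∀ x : ZMod 2, x + x = 0 := zmod_two_add_self
  have hu0 : p.1 0 = 0 := by linear_combination a1 - h2 (p.1 1)
  have hu1 : p.1 1 = p.2 0 := by linear_combination b1 - h2 (p.2 1) - h2 (p.2 0)
  have hu2 : p.1 2 = p.2 0 := by linear_combination b2 - h2 (p.2 2) - h2 (p.2 0)
  have hu3 : p.1 3 = p.2 0 := by linear_combination b3 - h2 (p.2 3) - h2 (p.2 0)
  have hu4 : p.1 4 = p.2 0 := by linear_combination b4 - h2 (p.2 4) - h2 (p.2 0)
  have hv0 : p.2 0 = 0 := by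
    linear_combination a0 - hu1 - hu2 - hu3 - hu4 - 10 * hu0 - 2 * h2 (p.2 0)
  have hv1 : p.2 1 = p.2 2 + p.2 3 + p.2 4 := by
    linear_combination b0 - 2 * hu0 - 10 * hv0 - h2 (p.2 2) - h2 (p.2 3) - h2 (p.2 4)
  refine ⟨?_, hv0, hv1⟩
  funext i
  fin_cases i
  · exact hu0
  · exact hu1.trans hv0
  · exact hu2.trans hv0
  · exact hu3.trans hv0
  · exact hu4.trans hv0

/-- The three vertical pairs `(0, e₁+e₂), (0, e₁+e₃), (0, e₁+e₄)` lie in the even virtual kernel of the explicit base. -/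
private theorem cex_mem (t : Fin 3) :
    ((![((0 : Fin 5 → ZMod 2), (![0, 1, 1, 0, 0] : Fin 5 → ZMod 2)), (0, ![0, 1, 0, 1, 0]), (0, ![0, 1, 0, 0, 1])] t) ∈
      (⟨![1, 2, 2, 2, 2], fun i _ => decide (i = 0)⟩ : SymbData 5).evenVirtualKernel) := by
  rw [mem_evenVirtualKernel_iff]
  revert t
  decide

/-- They are linearly independent. -/
private theorem cex_linearIndependent :
    LinearIndependent (ZMod 2)
      (![((0 : Fin 5 → ZMod 2), (![0, 1, 1, 0, 0] : Fin 5 → ZMod 2)), (0, ![0, 1, 0, 1, 0]), (0, ![0, 1, 0, 0, 1])]) := by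
  rw [Fintype.linearIndependent_iff]
  intro g hg t
  have h2 := congrFun (congrArg Prod.snd hg) 2
  have h3 := congrFun (congrArg Prod.snd hg) 3
  have h4 := congrFun (congrArg Prod.snd hg) 4
  simp [Fin.sum_univ_succ] at h2 h3 h4
  fin_cases t
  · exact h2
  · exact h3
  · exact h4

/-- ★ Lower bound: for EVERY `δ`, the `V × 0` section of the even pencil of the explicit base has dimension `≥ 3`. -/
theorem cex_three_le_finrank_section (δ : Fin 5 → ZMod 2) :
    3 ≤ finrank (ZMod 2) ↥((⟨![1, 2, 2, 2, 2], fun i _ => decide (i = 0)⟩ : SymbData 5).evenPencil δ ⊓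
      LinearMap.ker (LinearMap.snd (ZMod 2) (Fin 5 → ZMod 2) (Fin 5 → ZMod 2))) := by
  set v : Fin 3 → (Fin 5 → ZMod 2) × (Fin 5 → ZMod 2) :=
    ![((0 : Fin 5 → ZMod 2), (![0, 1, 1, 0, 0] : Fin 5 → ZMod 2)), (0, ![0, 1, 0, 1, 0]), (0, ![0, 1, 0, 0, 1])] with hv
  have hcard : finrank (ZMod 2) ↥(Submodule.span (ZMod 2) (Set.range v)) = 3 := by
    rw [finrank_span_eq_card cex_linearIndependent]; simp
  have hle : Submodule.span (ZMod 2) (Set.range v) ≤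
      (⟨![1, 2, 2, 2, 2], fun i _ => decide (i = 0)⟩ : SymbData 5).evenVirtualKernel := by
    rw [Submodule.span_le]
    rintro x ⟨t, rfl⟩
    exact cex_mem t
  have h0 : ∀ p ∈ Submodule.span (ZMod 2) (Set.range v), p.1 = 0 := by
    intro p hp
    refine Submodule.span_induction (p := fun q _ => q.1 = 0) ?_ rfl (fun x y _ _ hx hy => ?_) (fun c x _ hx => ?_) hp
    · rintro x ⟨t, rfl⟩
      fin_cases t <;> rfl
    · simp [hx, hy]
    · simp [hx]
  have key := finrank_le_evenPencil_inf_ker_snd _ δ _ hle h0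
  rw [hcard] at key
  exact key

/-- ★ Upper bound: the even virtual kernel of the explicit base has dimension `≤ 3` (it is read off the coordinates `v₂, v₃, v₄`). -/
theorem cex_finrank_kernel_le :
    finrank (ZMod 2) ↥((⟨![1, 2, 2, 2, 2], fun i _ => decide (i = 0)⟩ : SymbData 5).evenVirtualKernel) ≤ 3 := by
  set K := (⟨![1, 2, 2, 2, 2], fun i _ => decide (i = 0)⟩ : SymbData 5).evenVirtualKernel with hK
  let f : ↥K →ₗ[ZMod 2] (Fin 3 → ZMod 2) :=
    LinearMap.pi fun t : Fin 3 =>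
      (LinearMap.proj ((![2, 3, 4] : Fin 3 → Fin 5) t)).comp ((LinearMap.snd (ZMod 2) (Fin 5 → ZMod 2) (Fin 5 → ZMod 2)).comp K.subtype)
  have hf : ∀ (q : ↥K) (t : Fin 3), f q t = (q : (Fin 5 → ZMod 2) × (Fin 5 → ZMod 2)).2 ((![2, 3, 4] : Fin 3 → Fin 5) t) :=
    fun q t => rfl
  have hinj : Function.Injective f := by
    rw [injective_iff_map_eq_zero]
    intro q hq
    obtain ⟨h1, h0, h1'⟩ := cex_kernel_shape (q : (Fin 5 → ZMod 2) × (Fin 5 → ZMod 2)) q.2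
    have e2 : (q : (Fin 5 → ZMod 2) × (Fin 5 → ZMod 2)).2 2 = 0 := by
      have := congrFun hq 0; rw [hf] at this; simpa using this
    have e3 : (q : (Fin 5 → ZMod 2) × (Fin 5 → ZMod 2)).2 3 = 0 := by
      have := congrFun hq 1; rw [hf] at this; simpa using this
    have e4 : (q : (Fin 5 → ZMod 2) × (Fin 5 → ZMod 2)).2 4 = 0 := by
      have := congrFun hq 2; rw [hf] at this; simpa using this
    have e1 : (q : (Fin 5 → ZMod 2) × (Fin 5 → ZMod 2)).2 1 = 0 := by rw [h1', e2, e3, e4]; simp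
    apply Subtype.ext
    refine Prod.ext h1 ?_
    funext i
    fin_cases i
    · exact h0
    · exact e1
    · exact e2
    · exact e3
    · exact e4
  have := LinearMap.finrank_le_finrank_of_injective hinj
  simpa [Module.finrank_fintype_fun_eq_card] using this

/-- ★ Every even pencil of the explicit base has dimension `≤ 4`. -/
theorem cex_finrank_pencil_le (δ : Fin 5 → ZMod 2) :
    finrank (ZMod 2) ↥((⟨![1, 2, 2, 2, 2], fun i _ => decide (i = 0)⟩ : SymbData 5).evenPencil δ) ≤ 4 := by
  unfold SymbData.evenPencil
  refine (Submodule.finrank_add_le_finrank_add_finrank _ _).trans ?_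
  have h1 := (Submodule.finrank_map_le ((⟨![1, 2, 2, 2, 2], fun i _ => decide (i = 0)⟩ : SymbData 5).evenTwist δ)
    ((⟨![1, 2, 2, 2, 2], fun i _ => decide (i = 0)⟩ : SymbData 5).evenVirtualKernel)).trans cex_finrank_kernel_le
  have h2 : finrank (ZMod 2) ↥(Submodule.span (ZMod 2)
      ({((δ, fun i => 1 + δ i) : (Fin 5 → ZMod 2) × (Fin 5 → ZMod 2))} :
        Set ((Fin 5 → ZMod 2) × (Fin 5 → ZMod 2)))) ≤ 1 := by
    refine (finrank_span_le_card _).trans ?_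
    simp
  omega

/-- ★★★ **EVEN UNIVERSALITY FAILS (the first even exceptional base, kernel-checked).** For the base with classes `(3,5,5,5,5) mod 8`,
`(P_j/P₀) = −1` and `(P_i/P_j) = +1` — an even root-number-`−1` base (`μ = 1`) — and for EVERY `(2/·)`-vector `δ` and every `τ` with
`finrank W_ev(δ) = 2τ`, the `V × 0` section of the even pencil has dimension `> τ`: hypothesis `h1` of EVEN THEOREM A
(`exists_patternFree_even_design_pencil`) fails for all `δ`. Refutes the conjecture «EVEN UNIVERSALITY» of memo THEOREM-B-w3g23 §5.
[cite: HeathBrown1994SelmerCongruentII, Appendix (Monsky), typescript p. 41 L20–L36] -/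
theorem even_universality_fails :
    ∃ base : SymbData 5, (∑ b, bz (negNegOne (base.cls b))) = 1 ∧
      ∀ (δ : Fin 5 → ZMod 2) (τ : ℕ), finrank (ZMod 2) ↥(base.evenPencil δ) = 2 * τ →
        τ < finrank (ZMod 2) ↥(base.evenPencil δ ⊓
          LinearMap.ker (LinearMap.snd (ZMod 2) (Fin 5 → ZMod 2) (Fin 5 → ZMod 2))) := by
  refine ⟨⟨![1, 2, 2, 2, 2], fun i _ => decide (i = 0)⟩, by decide, fun δ τ hdim => ?_⟩
  have h4 := cex_finrank_pencil_le δ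
  have h3 := cex_three_le_finrank_section δ
  omega

end Cex

end Summit.BirchSwinnertonDyer.BirchSwinnertonDyer.Theorems.SymbolicMonsky
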